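import Mathlib.Topology.UrysohnsLemma
import Literature.Probability.Percolation.Z2PivotalCampbellLimit
import Literature.Probability.Percolation.FlipFairKernel
import Summits.CriticalPhenomena.CardyFormulaZ2.Theorems.CardyMeckeFlipFlipErgodicityZ2StubKernelExistsZ2OfLatticeFirstMomentLower

/-!
# Crux `FlipErgodicityZ2` (stmt-CriticalPhenomena-14825), line `registered`, stub
# `stub_kernelExistsZ2_of_lattice`: clause (ADM)(5) of every pivotal-kernel limit

Route `Summits/CriticalPhenomena/CardyFormulaZ2/Theses/CardyMeckeFlip`.  Helper file (supports the
crux item).  The stub asks, for every subsequential quad-crossing limit `μ` of bond-`ℤ²`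
percolation, for a Garban–Pete–Schramm pivotal-kernel limit `M` (`IsZ2PivotalKernelLimit μ M`,
`Z2PivotalMeasure.lean`) that is ADMISSIBLE (`IsAdmissibleKernel`, `FlipFairKernel.lean`).  This
file discharges clause (5) of admissibility — **non-degeneracy: some cutoff kernel charges the
unit ball with positive expected mass** — for EVERY pivotal-kernel limit with measurable cutoff
kernels, from the stub's second hypothesis (uniform second moments of the lattice kernels) alone:

  `IsZ2PivotalKernelLimit μ M → Measurable (M ε) → 0 < ε ≤ 1/8 →
     1/64 ≤ ∫⁻ S, M ε S (ball 0 1) ∂μ`          (`lintegral_kernel_ball_ge_of_isZ2PivotalKernelLimit`),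

hence `∃ ε > 0, 0 < ∫⁻ S, M ε S (ball 0 1) ∂μ` (`exists_lintegral_kernel_ball_pos`).

Proof.  Squeeze a test function `φ ∈ C_c(ℂ)`, `1_{B(0,1/2)} ≤ φ ≤ 1_{B(0,1)}` (Urysohn).  On the
lattice, `E[⟨μ^ε_δ, φ⟩] ≥ E[μ^ε_δ(B(0,1/2))] ≥ 1/64` uniformly in `0 < δ ≤ ε ≤ 1/8`
(`lintegral_z2PivotalMeasure_ball_radius_ge`: the bound of the sibling helper file
`…FirstMomentLower.lean` at every radius `ρ`, `E[μ^ε_δ(B(0,ρ))] ≥ ρ²/16` for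
`0 < δ ≤ ε ≤ min(1/8, ρ/4)` — each of the `(2k+1)² ≥ ρ²/(16δ²)` horizontal edges started in
`[-k,k]²`, `k = ⌊ρ/(4δ)⌋`, has its midpoint in `B(0,ρ)` and expected weight `≥ δ²`).  Along the
mesh sequence
of the limit, `(ω_δ, ⟨μ^ε_δ, φ⟩) ⇒ (S, ⟨M ε S, φ⟩)` jointly and the second moments are uniformly
bounded, so the MEANS converge (`tendsto_integral_mul_indicator_of_tendsto_pair` of
`JointLawTruncatedLimitGlue.lean` on the whole space): `E_μ[⟨M ε S, φ⟩] ≥ 1/64`.  Finally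
`ofReal ⟨M ε S, φ⟩ ≤ M ε S (B(0,1))` pointwise — including where the Bochner integral is junk —
and `ofReal ∫ ≤ ∫⁻ ofReal`.  No local finiteness of the limit kernel is needed.
-/

noncomputable section

open MeasureTheory Set Filter Metric
open Literature.Probability.Percolation Literature.Probability.Percolation.QuadCrossing
open Literature.Probability.LatticeModels Literature.Probability.Distributions
open scoped ENNReal Topology

namespace Summit.CriticalPhenomena.CardyFormulaZ2.Theorems.CardyMeckeFlip

/-! ### The lattice first moment of every ball -/

/-- **The horizontal edges started in `[-k,k]²`, `k = ⌊ρ/(4δ)⌋`, have their midpoints in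
`ball 0 ρ`** (`0 < δ ≤ ρ/4`). [folklore] -/
theorem edgeMidpoint_mem_ball_of_mem_box_radius {ρ δ : ℝ} (hδ : 0 < δ) (hδρ : δ ≤ ρ / 4)
    {x : Site 2} (hx : x ∈ box 2 ⌊ρ * (4 * δ)⁻¹⌋₊) (i : Fin 2) :
    edgeMidpoint δ x i ∈ ball (0 : ℂ) ρ := by
  rw [mem_ball, dist_zero_right]
  have hρ : 0 < ρ := by linarith
  have hk : (⌊ρ * (4 * δ)⁻¹⌋₊ : ℝ) ≤ ρ * (4 * δ)⁻¹ := Nat.floor_le (by positivity)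
  have hmid := dist_meshPoint_edgeMidpoint_le hδ x i
  rw [dist_comm, dist_eq_norm] at hmid
  have hxnorm : ‖meshPoint δ x‖ ≤ ρ / 2 := by
    rw [meshPoint, norm_mul, Complex.norm_real, Real.norm_eq_abs, abs_of_pos hδ]
    have hbox := mem_box.1 hx
    have hre : |(Site.toComplex x).re| ≤ ⌊ρ * (4 * δ)⁻¹⌋₊ := by
      rw [Site.toComplex_re, ← Int.cast_natCast, ← Int.cast_abs]
      exact_mod_cast abs_le.2 (hbox 0)
    have him : |(Site.toComplex x).im| ≤ ⌊ρ * (4 * δ)⁻¹⌋₊ := by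
      rw [Site.toComplex_im, ← Int.cast_natCast, ← Int.cast_abs]
      exact_mod_cast abs_le.2 (hbox 1)
    calc δ * ‖Site.toComplex x‖
        ≤ δ * (|(Site.toComplex x).re| + |(Site.toComplex x).im|) :=
          mul_le_mul_of_nonneg_left (Complex.norm_le_abs_re_add_abs_im _) hδ.le
      _ ≤ δ * (ρ * (4 * δ)⁻¹ + ρ * (4 * δ)⁻¹) := by gcongr <;> linarith
      _ = ρ / 2 := by field_simp; ring
  calc ‖edgeMidpoint δ x i‖
      ≤ ‖meshPoint δ x‖ + ‖edgeMidpoint δ x i - meshPoint δ x‖ := norm_le_insert' _ _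
    _ ≤ ρ / 2 + δ := add_le_add hxnorm hmid
    _ < ρ := by linarith

/-- **The lattice first moment of every ball is bounded below, uniformly in the mesh**: for
`ρ > 0` and `0 < δ ≤ ε ≤ min(1/8, ρ/4)`,

  `ρ²/16 ≤ E_{1/2}[μ^ε_δ(ω)(ball 0 ρ)]`,

`μ^ε_δ = z2PivotalMeasure ε δ` the isometry-averaged normalised `ε`-important measure of
bond-`ℤ²` (the lattice side of clause (ADM)(5) at every radius). [folklore] -/
theorem lintegral_z2PivotalMeasure_ball_radius_ge :
    ∀ ρ : ℝ, 0 < ρ → ∀ ε : ℝ, 0 < ε → ε ≤ 1 / 8 → ε ≤ ρ / 4 → ∀ δ : ℝ, 0 < δ → δ ≤ ε →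
      ENNReal.ofReal (ρ ^ 2 / 16) ≤
        ∫⁻ ω, z2PivotalMeasure ε δ ω (Metric.ball 0 ρ) ∂(bondPercolation (zdGraph 2) half) := by
  intro ρ hρ ε hε hε8 hερ δ hδ hδε
  set P := bondPercolation (zdGraph 2) half with hP
  have hδρ : δ ≤ ρ / 4 := hδε.trans hερ
  have h421 : 4 * ε + 2 * δ ≤ 1 := by linarith
  set k : ℕ := ⌊ρ * (4 * δ)⁻¹⌋₊ with hkdef
  set E : Finset (Site 2 × Fin 2) := box 2 k ×ˢ {0} with hEdef
  have hEball : ∀ p ∈ E, edgeMidpoint δ p.1 p.2 ∈ ball (0 : ℂ) ρ := by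
    rintro ⟨x, i⟩ hp
    rw [hEdef, Finset.mem_product] at hp
    exact edgeMidpoint_mem_ball_of_mem_box_radius hδ hδρ hp.1 i
  have hcard : (E.card : ℝ≥0∞) = ENNReal.ofReal ((2 * (k : ℝ) + 1) ^ 2) := by
    rw [hEdef, Finset.card_product, card_box, Finset.card_singleton, mul_one]
    rw [show ((2 * (k : ℝ) + 1) ^ 2) = (((2 * k + 1) ^ 2 : ℕ) : ℝ) by push_cast; ring,
      ENNReal.ofReal_natCast]
  -- `(2k+1) δ ≥ ρ/2 - δ ≥ ρ/4`
  have hklt : ρ * (4 * δ)⁻¹ < (k : ℝ) + 1 := Nat.lt_floor_add_one _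
  have hkδ : ρ / 4 ≤ (2 * (k : ℝ) + 1) * δ := by
    have h4 : ρ * (4 * δ)⁻¹ * δ = ρ / 4 := by field_simp
    nlinarith
  have hconst : ρ ^ 2 / 16 ≤ (2 * (k : ℝ) + 1) ^ 2 * δ ^ 2 := by
    have : (ρ / 4) ^ 2 ≤ ((2 * (k : ℝ) + 1) * δ) ^ 2 :=
      pow_le_pow_left₀ (by positivity) hkδ 2
    nlinarith
  calc ENNReal.ofReal (ρ ^ 2 / 16)
      ≤ ENNReal.ofReal ((2 * (k : ℝ) + 1) ^ 2 * δ ^ 2) := ENNReal.ofReal_le_ofReal hconst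
    _ = ∑ p ∈ E, ENNReal.ofReal (δ ^ 2) := by
        rw [Finset.sum_const, nsmul_eq_mul, hcard, ← ENNReal.ofReal_mul (sq_nonneg _)]
    _ ≤ ∑ p ∈ E, ∫⁻ ω, pivotalWeight ε δ ω p.1 p.2 ∂P :=
        Finset.sum_le_sum fun p _ => lintegral_pivotalWeight_ge hδ hδε h421 p.1 p.2
    _ = ∫⁻ ω, ∑ p ∈ E, pivotalWeight ε δ ω p.1 p.2 ∂P :=
        (lintegral_finsetSum E fun p _ => measurable_pivotalWeight hε hδ p.1 p.2).symm
    _ ≤ ∫⁻ ω, z2PivotalMeasure ε δ ω (ball 0 ρ) ∂P :=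
        lintegral_mono fun ω => sum_pivotalWeight_le_z2PivotalMeasure ε δ ω E hEball

/-! ### Two pointwise comparisons between a measure and the integral of a test function -/

/-- `ofReal (∫ f) ≤ ∫⁻ ofReal ∘ f` for a non-negative `f` and EVERY measure (equality when `f` is
integrable, `ofReal_integral_eq_lintegral_ofReal`; the Bochner integral is `0` otherwise).
[folklore] -/
theorem ofReal_integral_le_lintegral_ofReal_of_nonneg {α : Type*} [MeasurableSpace α]
    (m : Measure α) {f : α → ℝ} (h0 : ∀ x, 0 ≤ f x) :
    ENNReal.ofReal (∫ x, f x ∂m) ≤ ∫⁻ x, ENNReal.ofReal (f x) ∂m := by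
  by_cases hf : Integrable f m
  · exact (ofReal_integral_eq_lintegral_ofReal hf (ae_of_all _ h0)).le
  · rw [integral_undef hf, ENNReal.ofReal_zero]
    exact bot_le


/-- **A set on which `φ ≥ 1` has mass at most `∫ φ`** (`φ ≥ 0` continuous with compact support,
the measure finite on compacts, so that `φ` is integrable). [folklore] -/
theorem measure_le_ofReal_integral_of_one_le (m : Measure ℂ) [IsFiniteMeasureOnCompacts m]
    {φ : ℂ → ℝ} (hφ : Continuous φ) (hφc : HasCompactSupport φ) (h0 : ∀ x, 0 ≤ φ x) {s : Set ℂ}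
    (h1 : ∀ x ∈ s, 1 ≤ φ x) : m s ≤ ENNReal.ofReal (∫ x, φ x ∂m) := by
  have ht : MeasurableSet {x | 1 ≤ φ x} := (isClosed_le continuous_const hφ).measurableSet
  calc m s ≤ m {x | 1 ≤ φ x} := measure_mono fun x hx => h1 x hx
    _ = ∫⁻ x, {x | 1 ≤ φ x}.indicator 1 x ∂m := (lintegral_indicator_one ht).symm
    _ ≤ ∫⁻ x, ENNReal.ofReal (φ x) ∂m := by
        refine lintegral_mono fun x => ?_
        by_cases hx : x ∈ {x | 1 ≤ φ x}
        · rw [indicator_of_mem hx, Pi.one_apply, ← ENNReal.ofReal_one]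
          exact ENNReal.ofReal_le_ofReal hx
        · rw [indicator_of_notMem hx]
          exact bot_le
    _ = ENNReal.ofReal (∫ x, φ x ∂m) :=
        (ofReal_integral_eq_lintegral_ofReal (hφ.integrable_of_hasCompactSupport hφc)
          (ae_of_all _ h0)).symm

/-- **`ofReal (∫ φ) ≤ m s` when `0 ≤ φ ≤ 1_s`**, for EVERY measure `m` (where `φ` is not
`m`-integrable the Bochner integral is `0`). [folklore] -/
theorem ofReal_integral_le_measure_of_le_indicator (m : Measure ℂ) {φ : ℂ → ℝ}
    (h0 : ∀ x, 0 ≤ φ x) {s : Set ℂ} (hs : MeasurableSet s)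
    (hle : ∀ x, φ x ≤ s.indicator 1 x) : ENNReal.ofReal (∫ x, φ x ∂m) ≤ m s := by
  calc ENNReal.ofReal (∫ x, φ x ∂m) ≤ ∫⁻ x, ENNReal.ofReal (φ x) ∂m :=
        ofReal_integral_le_lintegral_ofReal_of_nonneg m h0
    _ ≤ ∫⁻ x, s.indicator 1 x ∂m := by
        refine lintegral_mono fun x => ?_
        have hx := hle x
        by_cases hxs : x ∈ s
        · rw [indicator_of_mem hxs, Pi.one_apply] at hx ⊢
          rw [← ENNReal.ofReal_one]
          exact ENNReal.ofReal_le_ofReal hx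
        · rw [indicator_of_notMem hxs] at hx ⊢
          rw [ENNReal.ofReal_of_nonpos hx]
    _ = m s := lintegral_indicator_one hs

/-- A squeezed test function: `φ ∈ C_c(ℂ)` with `1_{B̄(0,1/2)} ≤ φ ≤ 1_{B(0,1)}` (Urysohn's lemma
in the locally compact plane). [folklore] -/
theorem exists_testFunction_halfBall_ball :
    ∃ φ : ℂ → ℝ, Continuous φ ∧ HasCompactSupport φ ∧ (∀ x, 0 ≤ φ x) ∧
      (∀ x ∈ closedBall (0 : ℂ) (1 / 2), 1 ≤ φ x) ∧ ∀ x, φ x ≤ (ball (0 : ℂ) 1).indicator 1 x := by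
  obtain ⟨f, hf1, hf0, hfc, hf01⟩ := exists_continuous_one_zero_of_isCompact
    (isCompact_closedBall (0 : ℂ) (1 / 2)) (isOpen_ball (x := (0 : ℂ)) (ε := 1)).isClosed_compl
    (disjoint_compl_right_iff_subset.2 (closedBall_subset_ball (by norm_num)))
  refine ⟨f, f.continuous, hfc, fun x => (hf01 x).1, fun x hx => (hf1 hx).ge, fun x => ?_⟩
  by_cases hx : x ∈ ball (0 : ℂ) 1
  · rw [indicator_of_mem hx, Pi.one_apply]
    exact (hf01 x).2
  · rw [indicator_of_notMem hx]
    exact (hf0 hx).le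

/-! ### The lattice means are bounded below -/

/-- **`E_{1/2}[⟨μ^ε_δ, φ⟩] ≥ 1/64`** for `0 < δ ≤ ε ≤ 1/8` and every `φ ∈ C_c(ℂ)`, `φ ≥ 0`,
`φ ≥ 1` on `B̄(0,1/2)` (from `lintegral_z2PivotalMeasure_ball_radius_ge` at radius `1/2`).
[folklore] -/
theorem integral_integral_z2PivotalMeasure_ge {ε δ : ℝ} (hε : 0 < ε) (hε8 : ε ≤ 1 / 8)
    (hδ : 0 < δ) (hδε : δ ≤ ε) {φ : ℂ → ℝ} (hφ : Continuous φ) (hφc : HasCompactSupport φ)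
    (h0 : ∀ x, 0 ≤ φ x) (h1 : ∀ x ∈ closedBall (0 : ℂ) (1 / 2), 1 ≤ φ x) :
    (1 : ℝ) / 64 ≤
      ∫ ω, ∫ x, φ x ∂(z2PivotalMeasure ε δ ω) ∂(bondPercolation (zdGraph 2) half) := by
  set P := bondPercolation (zdGraph 2) half with hP
  have hlat := lintegral_z2PivotalMeasure_ball_radius_ge (1 / 2) (by norm_num) ε hε hε8
    (by linarith) δ hδ hδε
  have hpt : ∀ ω, z2PivotalMeasure ε δ ω (ball 0 (1 / 2)) ≤
      ENNReal.ofReal (∫ x, φ x ∂(z2PivotalMeasure ε δ ω)) := fun ω => by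
    haveI := isFiniteMeasureOnCompacts_z2PivotalMeasure ε hδ ω
    exact (measure_mono ball_subset_closedBall).trans
      (measure_le_ofReal_integral_of_one_le _ hφ hφc h0 h1)
  have hint : Integrable (fun ω => ∫ x, φ x ∂(z2PivotalMeasure ε δ ω)) P :=
    integrable_integral_z2PivotalMeasure hε hδ hφ hφc
  have hnn : 0 ≤ ∫ ω, ∫ x, φ x ∂(z2PivotalMeasure ε δ ω) ∂P :=
    integral_nonneg fun ω => integral_nonneg h0
  have key : ENNReal.ofReal ((1 / 2 : ℝ) ^ 2 / 16) ≤
      ENNReal.ofReal (∫ ω, ∫ x, φ x ∂(z2PivotalMeasure ε δ ω) ∂P) :=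
    calc ENNReal.ofReal ((1 / 2 : ℝ) ^ 2 / 16)
        ≤ ∫⁻ ω, z2PivotalMeasure ε δ ω (ball 0 (1 / 2)) ∂P := hlat
      _ ≤ ∫⁻ ω, ENNReal.ofReal (∫ x, φ x ∂(z2PivotalMeasure ε δ ω)) ∂P := lintegral_mono hpt
      _ = ENNReal.ofReal (∫ ω, ∫ x, φ x ∂(z2PivotalMeasure ε δ ω) ∂P) :=
          (ofReal_integral_eq_lintegral_ofReal hint
            (ae_of_all _ fun ω => integral_nonneg h0)).symm
  have := (ENNReal.ofReal_le_ofReal_iff hnn).1 key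
  norm_num at this
  linarith

/-! ### Clause (ADM)(5) for every pivotal-kernel limit -/

/-- **Clause (ADM)(5) of every Garban–Pete–Schramm pivotal-kernel limit of bond-`ℤ²`**, from the
uniform second moments of the lattice kernels: if `M` is a pivotal-kernel limit of the
subsequential quad-crossing limit `μ` (`IsZ2PivotalKernelLimit μ M`) with `M ε` measurable,
`0 < ε ≤ 1/8`, then

  `1/64 ≤ ∫⁻ S, M ε S (ball 0 1) ∂μ`.

(Lattice lower bound `E[⟨μ^ε_δ, φ⟩] ≥ 1/64` for a squeezed `φ`, convergence of the means by
uniform integrability, and `ofReal ⟨M ε S, φ⟩ ≤ M ε S (B(0,1))` pointwise.) [folklore] -/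
theorem lintegral_kernel_ball_ge_of_isZ2PivotalKernelLimit
    (hmom : ∀ ε : ℝ, 0 < ε → ∀ φ : ℂ → ℝ, Continuous φ → HasCompactSupport φ →
      ∃ C δ₀ : ℝ, 0 < δ₀ ∧ ∀ δ : ℝ, 0 < δ → δ ≤ δ₀ →
        ∫ ω, (∫ x, |φ x| ∂(z2PivotalMeasure ε δ ω)) ^ 2 ∂(bondPercolation (zdGraph 2) half) ≤ C)
    (μ : FiniteMeasure (QuadConfig (univ : Set ℂ)))
    (M : ℝ → QuadConfig (univ : Set ℂ) → Measure ℂ) (hlim : IsZ2PivotalKernelLimit μ M)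
    {ε : ℝ} (hε : 0 < ε) (hε8 : ε ≤ 1 / 8) (hM : Measurable (M ε)) :
    ENNReal.ofReal (1 / 64) ≤
      ∫⁻ S, M ε S (Metric.ball 0 1) ∂(μ : Measure (QuadConfig (univ : Set ℂ))) := by
  haveI : TopologicalSpace.MetrizableSpace (QuadConfig (univ : Set ℂ)) :=
    (SchrammSmirnov2011_thm_1_4_holds univ isOpen_univ univ_nonempty).1.2.1
  haveI : IsProbabilityMeasure (bondPercolation (zdGraph 2) half) := by
    unfold bondPercolation; infer_instance
  set P := bondPercolation (zdGraph 2) half with hP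
  -- the squeezed test function
  obtain ⟨φ, hφ, hφc, h0, h1, hle⟩ := exists_testFunction_halfBall_ball
  have habs : (fun x => |φ x|) = φ := funext fun x => abs_of_nonneg (h0 x)
  -- the mesh sequence of the limit, shifted so that `δ_k ≤ min δ₀ ε`
  obtain ⟨δs, hpos, hδ0, -, hconv⟩ := hlim
  obtain ⟨C, δ₀, hδ₀, hC⟩ := hmom ε hε φ hφ hφc
  rw [habs] at hC
  obtain ⟨k₀, hk₀⟩ := (hδ0.eventually (Iio_mem_nhds (lt_min hδ₀ hε))).exists_forall_of_atTop
  set δs' : ℕ → ℝ := fun k => δs (k + k₀) with hδs'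
  have hpos' : ∀ k, 0 < δs' k := fun k => hpos _
  have hle₀ : ∀ k, δs' k ≤ δ₀ := fun k =>
    ((hk₀ (k + k₀) (Nat.le_add_left _ _)).le.trans (min_le_left _ _))
  have hleε : ∀ k, δs' k ≤ ε := fun k =>
    ((hk₀ (k + k₀) (Nat.le_add_left _ _)).le.trans (min_le_right _ _))
  -- the lattice functionals `t_k = ⟨μ^ε_{δ'_k}, φ⟩` and their limit `tlim S = ⟨M ε S, φ⟩`
  set X : ℕ → BondConfig (Site 2) → QuadConfig (univ : Set ℂ) := fun k =>
    z2QuadConfig (univ : Set ℂ) (δs' k) with hX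
  set t : ℕ → BondConfig (Site 2) → ℝ := fun k ω =>
    ∫ x, φ x ∂(z2PivotalMeasure ε (δs' k) ω) with ht
  set tlim : QuadConfig (univ : Set ℂ) → ℝ := fun S => ∫ x, φ x ∂(M ε S) with htlim
  have hXm : ∀ k, Measurable (X k) := fun k => measurable_z2QuadConfig isOpen_univ (hpos' k)
  have htm : ∀ k, Measurable (t k) := fun k =>
    measurable_integral_z2PivotalMeasure hε (hpos' k) hφ hφc
  have htlimm : Measurable tlim := measurable_integral_of_measurable_measure hM hφ.stronglyMeasurable
  have ht0 : ∀ k ω, 0 ≤ t k ω := fun k ω => integral_nonneg h0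
  have htlim0 : ∀ S, 0 ≤ tlim S := fun S => integral_nonneg h0
  have hti : ∀ k, Integrable (t k) P := fun k =>
    integrable_integral_z2PivotalMeasure hε (hpos' k) hφ hφc
  have hint : ∀ k, Integrable (fun ω => t k ω ^ 2) P := fun k =>
    integrable_sq_integral_z2PivotalMeasure hε (hpos' k) hφ hφc
  have hC' : ∀ k, ∫ ω, t k ω ^ 2 ∂P ≤ C := fun k => hC (δs' k) (hpos' k) (hle₀ k)
  -- joint convergence of `(ω_δ, t_k)` to `(S, tlim S)`, along the shifted sequence
  have hpair : ∀ F : BoundedContinuousFunction (QuadConfig (univ : Set ℂ) × ℝ) ℝ,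
      Tendsto (fun k => ∫ ω, F (X k ω, t k ω) ∂P) atTop
        (𝓝 (∫ S, F (S, tlim S) ∂(μ : Measure (QuadConfig (univ : Set ℂ))))) := by
    refine tendsto_pair_of_tendsto_fin_one fun G => ?_
    have h := hconv ε hε 1 (fun _ => φ) (fun _ => hφ) (fun _ => hφc) G
    exact h.comp (tendsto_add_atTop_nat k₀)
  -- convergence of the means (uniform integrability from the second moments)
  have hmean := tendsto_integral_mul_indicator_of_tendsto_pair (μ := (μ : Measure _)) hXm htm
    htlimm ht0 htlim0 hpair hti hint hC' MeasurableSet.univ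
    (by rw [frontier_univ, measure_empty])
  simp only [indicator_univ, Pi.one_apply, mul_one] at hmean
  -- the lattice means are `≥ 1/64`, hence so is the limit mean
  have hlat : ∀ k, (1 : ℝ) / 64 ≤ ∫ ω, t k ω ∂P := fun k =>
    integral_integral_z2PivotalMeasure_ge hε hε8 (hpos' k) (hleε k) hφ hφc h0 h1
  have hlimit : (1 : ℝ) / 64 ≤ ∫ S, tlim S ∂(μ : Measure (QuadConfig (univ : Set ℂ))) :=
    ge_of_tendsto' hmean hlat
  -- `ofReal ⟨M ε S, φ⟩ ≤ M ε S (ball 0 1)` pointwise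
  calc ENNReal.ofReal (1 / 64)
      ≤ ENNReal.ofReal (∫ S, tlim S ∂(μ : Measure (QuadConfig (univ : Set ℂ)))) :=
        ENNReal.ofReal_le_ofReal hlimit
    _ ≤ ∫⁻ S, ENNReal.ofReal (tlim S) ∂(μ : Measure (QuadConfig (univ : Set ℂ))) :=
        ofReal_integral_le_lintegral_ofReal_of_nonneg _ htlim0
    _ ≤ ∫⁻ S, M ε S (ball 0 1) ∂(μ : Measure (QuadConfig (univ : Set ℂ))) :=
        lintegral_mono fun S =>
          ofReal_integral_le_measure_of_le_indicator (M ε S) h0 measurableSet_ball hle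

/-- **Clause (ADM)(5) for every pivotal-kernel limit with measurable cutoff kernels**: under the
uniform second moments of the lattice kernels, `∃ ε > 0, 0 < ∫⁻ S, M ε S (ball 0 1) ∂μ` — the
fifth conjunct of `IsAdmissibleKernel ↑μ M` in the conclusion of the stub, discharged for any
witness of its first conjunct `IsZ2PivotalKernelLimit μ M`. [folklore] -/
theorem exists_lintegral_kernel_ball_pos :
    (∀ ε : ℝ, 0 < ε → ∀ φ : ℂ → ℝ, Continuous φ → HasCompactSupport φ →
      ∃ C δ₀ : ℝ, 0 < δ₀ ∧ ∀ δ : ℝ, 0 < δ → δ ≤ δ₀ →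
        ∫ ω, (∫ x, |φ x| ∂(z2PivotalMeasure ε δ ω)) ^ 2 ∂(bondPercolation (zdGraph 2) half) ≤ C) →
    ∀ (μ : FiniteMeasure (QuadConfig (Set.univ : Set ℂ)))
      (M : ℝ → QuadConfig (Set.univ : Set ℂ) → Measure ℂ), IsZ2PivotalKernelLimit μ M →
        (∀ ε : ℝ, Measurable (M ε)) →
          ∃ ε : ℝ, 0 < ε ∧
            0 < ∫⁻ S, M ε S (Metric.ball 0 1) ∂(μ : Measure (QuadConfig (Set.univ : Set ℂ))) := by
  intro hmom μ M hlim hM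
  exact ⟨1 / 8, by norm_num, lt_of_lt_of_le (ENNReal.ofReal_pos.2 (by norm_num))
    (lintegral_kernel_ball_ge_of_isZ2PivotalKernelLimit hmom μ M hlim (by norm_num) le_rfl
      (hM _))⟩

end Summit.CriticalPhenomena.CardyFormulaZ2.Theorems.CardyMeckeFlip

end
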